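import Literature.Analysis.FluidPDE.TypeIAncientMildRescale
import HarnessLib

/-!
# Crux `FiniteDissipationLiouville` (stmt-NavierStokesRegularity-22144), line `birth`:
# tools for the LYAPUNOV REDUCTION — the scaling flow, the recurrence clause, LaSalle on the hull

Theorems file of route `LerayQuarterDissipation` (lead ns-lqd-lead g7), `--supports 22144`; the
reduction itself is `…FiniteDissipationLiouvilleLyapunov.lean`. Navier–Stokes regularity is NOT
proved by anything here; no summit is.

THE SCALING FLOW `σ ↦ W_σ := nsRescale (e^σ) W`, `W_σ(s,y) = e^σ W(e^{2σ}s, e^σ y)`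
(`nsRescale_exp_add`: `(W_σ)_τ = W_{σ+τ}`), and the route's UNIFORM RECURRENCE clause
(`∀ ε R, ∃ L, ∀ a, ∃ σ ∈ [a, a+L]`: `‖W_σ − W‖ ≤ ε` on the window `[−R², −R⁻²] × B̄(0,R)`):
* `recurrent_nsRescale` — the clause is invariant under the flow (window `R` for `W_c` is served
  by the window `(c + c⁻¹)R` for `W` with tolerance `ε/c`);
* `exists_seq_of_recurrent` — it yields `σ_n → +∞` with `W_{σ_n} → W` uniformly on every window;
* `const_of_antitone_of_recurrence` — real-variable core: an antitone `f : ℝ → ℝ` with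
  `f σ₀ − δ ≤ f σ` for arbitrarily large `σ` (all `σ₀`, `δ > 0`) is constant;
* `lyapunov_constant` — **LaSalle's invariance principle in the kernel's clauses**: for any
  scale-invariant property `P` implying uniform recurrence and any real function `F` of fields
  that is antitone along the flow on `P`-fields and lower semicontinuous along recurrence sequences
  (`ε`–`N` form), `σ ↦ F(W_σ)` is CONSTANT for every `P`-field `W`.
Folklore dynamics (LaSalle 1960; Furstenberg 1981 Ch. 1); no definitions; standard axioms.
-/

noncomputable section

-- the summit and its single sub-problem share the name (CONVENTIONS §1), as in every Theorems file
set_option linter.dupNamespace false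

namespace Summit.NavierStokesRegularity.NavierStokesRegularity.Theorems.FiniteDissipationLiouville.Lyapunov

open MeasureTheory Set Filter Topology Metric Function
open Literature.Analysis Literature.Analysis.FluidPDE
open scoped ENNReal NNReal

/-! ### The real-variable core -/

/-- **An antitone function which recurs to within every `δ` of each of its values arbitrarily far
to the right is constant.** -/
theorem const_of_antitone_of_recurrence {f : ℝ → ℝ} (hf : Antitone f)
    (hrec : ∀ σ₀ : ℝ, ∀ δ > 0, ∀ B : ℝ, ∃ σ, B ≤ σ ∧ f σ₀ - δ ≤ f σ) : ∀ a b, f a = f b := by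
  suffices h : ∀ a b, a ≤ b → f a = f b by
    intro a b
    rcases le_total a b with hab | hab
    · exact h a b hab
    · exact (h b a hab).symm
  intro a b hab
  refine le_antisymm ?_ (hf hab)
  refine le_of_forall_pos_le_add fun δ hδ => ?_
  obtain ⟨σ, hσ, hfa⟩ := hrec a δ hδ b
  linarith [hf hσ]

/-! ### The scaling flow and the recurrence clause -/

/-- The flow property `(W_σ)_τ = W_{σ+τ}` of `σ ↦ nsRescale (e^σ) W`. -/
theorem nsRescale_exp_add (σ τ : ℝ)
    (W : ℝ → EuclideanSpace ℝ (Fin 3) → EuclideanSpace ℝ (Fin 3)) :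
    nsRescale (Real.exp τ) (nsRescale (Real.exp σ) W) = nsRescale (Real.exp (σ + τ)) W := by
  rw [Real.exp_add, nsRescale_mul]

/-- `nsRescale (e^0) W = W`. -/
theorem nsRescale_exp_zero (W : ℝ → EuclideanSpace ℝ (Fin 3) → EuclideanSpace ℝ (Fin 3)) :
    nsRescale (Real.exp 0) W = W := by
  rw [Real.exp_zero, nsRescale_one]

/-- The recurrence clause's displacement is the flow: `e^σ • W (e^{2σ}s) (e^σ y) = (W_σ) s y`. -/
theorem exp_smul_eq_nsRescale (σ : ℝ)
    (W : ℝ → EuclideanSpace ℝ (Fin 3) → EuclideanSpace ℝ (Fin 3)) (s : ℝ)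
    (y : EuclideanSpace ℝ (Fin 3)) :
    Real.exp σ • W (Real.exp (2 * σ) * s) (Real.exp σ • y) = nsRescale (Real.exp σ) W s y := by
  rw [nsRescale_apply, show Real.exp (2 * σ) = Real.exp σ ^ 2 by
    rw [sq, ← Real.exp_add, two_mul]]

/-- Windows are nested: `[−R², −R⁻²] × B̄(0,R) ⊂ [−R'², −R'⁻²] × B̄(0,R')` for `0 < R ≤ R'`. -/
theorem window_mono {R R' : ℝ} (hR : 0 < R) (hRR' : R ≤ R') {s : ℝ}
    (hs : s ∈ Icc (-(R ^ 2)) (-(R⁻¹) ^ 2)) {y : EuclideanSpace ℝ (Fin 3)}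
    (hy : y ∈ closedBall (0 : EuclideanSpace ℝ (Fin 3)) R) :
    s ∈ Icc (-(R' ^ 2)) (-(R'⁻¹) ^ 2) ∧ y ∈ closedBall (0 : EuclideanSpace ℝ (Fin 3)) R' := by
  have hR' : 0 < R' := hR.trans_le hRR'
  refine ⟨⟨?_, ?_⟩, ?_⟩
  · have : R ^ 2 ≤ R' ^ 2 := pow_le_pow_left₀ hR.le hRR' 2
    linarith [hs.1]
  · have : R'⁻¹ ^ 2 ≤ R⁻¹ ^ 2 :=
      pow_le_pow_left₀ (inv_nonneg.2 hR'.le) ((inv_le_inv₀ hR' hR).2 hRR') 2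
    linarith [hs.2]
  · rw [mem_closedBall, dist_zero_right] at hy ⊢
    exact hy.trans hRR'

/-- **The recurrence clause is invariant under the scaling flow**: if `W` is uniformly recurrent,
so is `nsRescale c W` for every `c > 0` (the window `R` for `W_c` is served by the window
`(c + c⁻¹) R` for `W`, with tolerance `ε / c`). -/
theorem recurrent_nsRescale
    {W : ℝ → EuclideanSpace ℝ (Fin 3) → EuclideanSpace ℝ (Fin 3)}
    (hrec : ∀ ε > 0, ∀ R > 1, ∃ L > 0, ∀ a : ℝ, ∃ σ ∈ Set.Icc a (a + L),
      ∀ s ∈ Set.Icc (-(R ^ 2)) (-(R⁻¹) ^ 2),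
      ∀ y ∈ Metric.closedBall (0 : EuclideanSpace ℝ (Fin 3)) R,
        ‖Real.exp σ • W (Real.exp (2 * σ) * s) (Real.exp σ • y) - W s y‖ ≤ ε)
    {c : ℝ} (hc : 0 < c) :
    ∀ ε > 0, ∀ R > 1, ∃ L > 0, ∀ a : ℝ, ∃ σ ∈ Set.Icc a (a + L),
      ∀ s ∈ Set.Icc (-(R ^ 2)) (-(R⁻¹) ^ 2),
      ∀ y ∈ Metric.closedBall (0 : EuclideanSpace ℝ (Fin 3)) R,
        ‖Real.exp σ • nsRescale c W (Real.exp (2 * σ) * s) (Real.exp σ • y) -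
          nsRescale c W s y‖ ≤ ε := by
  intro ε hε R hR
  have hR0 : 0 < R := one_pos.trans hR
  -- the larger window `R' = (c + c⁻¹) R ≥ max (cR, R/c)`, and `R' > 1`
  set R' : ℝ := (c + c⁻¹) * R with hR'def
  have hcc : 2 ≤ c + c⁻¹ := by
    have : 0 ≤ (c - 1) ^ 2 / c := by positivity
    have e : c + c⁻¹ - 2 = (c - 1) ^ 2 / c := by field_simp; ring
    linarith
  have hR' : 1 < R' := by
    rw [hR'def]; nlinarith
  have hR'0 : 0 < R' := one_pos.trans hR'
  have hcR : c * R ≤ R' := by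
    rw [hR'def]
    have : c ≤ c + c⁻¹ := le_add_of_nonneg_right (inv_nonneg.2 hc.le)
    nlinarith
  have hRc : R / c ≤ R' := by
    rw [hR'def, div_eq_mul_inv, mul_comm R]
    have : c⁻¹ ≤ c + c⁻¹ := le_add_of_nonneg_left hc.le
    nlinarith
  obtain ⟨L, hL, hwin⟩ := hrec (ε / c) (div_pos hε hc) R' hR'
  refine ⟨L, hL, fun a => ?_⟩
  obtain ⟨σ, hσ, hclose⟩ := hwin a
  refine ⟨σ, hσ, fun s hs y hy => ?_⟩
  -- the point `(c² s, c y)` lies in the window `R'`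
  have hs' : c ^ 2 * s ∈ Set.Icc (-(R' ^ 2)) (-(R'⁻¹) ^ 2) := by
    constructor
    · have h1 : -(R ^ 2) ≤ s := hs.1
      have h2 : (c * R) ^ 2 ≤ R' ^ 2 := pow_le_pow_left₀ (by positivity) hcR 2
      nlinarith
    · have h1 : s ≤ -(R⁻¹) ^ 2 := hs.2
      have h3 : R'⁻¹ ≤ c / R := by
        rw [inv_le_comm₀ hR'0 (div_pos hc hR0), inv_div]
        exact hRc
      have h2 : R'⁻¹ ^ 2 ≤ (c / R) ^ 2 := pow_le_pow_left₀ (inv_nonneg.2 hR'0.le) h3 2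
      have e : (c / R) ^ 2 = c ^ 2 * R⁻¹ ^ 2 := by rw [div_eq_mul_inv, mul_pow]
      nlinarith
  have hy' : c • y ∈ Metric.closedBall (0 : EuclideanSpace ℝ (Fin 3)) R' := by
    rw [mem_closedBall, dist_zero_right, norm_smul, Real.norm_of_nonneg hc.le]
    rw [mem_closedBall, dist_zero_right] at hy
    nlinarith
  have key := hclose (c ^ 2 * s) hs' (c • y) hy'
  -- rewrite the displacement of `nsRescale c W` through that of `W` at `(c² s, c y)`
  have e : Real.exp σ • nsRescale c W (Real.exp (2 * σ) * s) (Real.exp σ • y) - nsRescale c W s y =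
      c • (Real.exp σ • W (Real.exp (2 * σ) * (c ^ 2 * s)) (Real.exp σ • (c • y)) -
        W (c ^ 2 * s) (c • y)) := by
    simp only [nsRescale_apply, smul_sub, smul_smul]
    congr 2
    · ring
    · congr 1
      · ring
      · rw [mul_comm]
  rw [e, norm_smul, Real.norm_of_nonneg hc.le]
  calc c * ‖Real.exp σ • W (Real.exp (2 * σ) * (c ^ 2 * s)) (Real.exp σ • (c • y)) -
        W (c ^ 2 * s) (c • y)‖ ≤ c * (ε / c) := by gcongr
    _ = ε := by field_simp

/-- **From the recurrence clause, a sequence `σ_n → +∞` with `W_{σ_n} → W` uniformly on every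
window** (`σ_n ∈ [n, n + L_n]` with tolerance `1/(n+1)` on the window `n + 2`). -/
theorem exists_seq_of_recurrent
    {W : ℝ → EuclideanSpace ℝ (Fin 3) → EuclideanSpace ℝ (Fin 3)}
    (hrec : ∀ ε > 0, ∀ R > 1, ∃ L > 0, ∀ a : ℝ, ∃ σ ∈ Set.Icc a (a + L),
      ∀ s ∈ Set.Icc (-(R ^ 2)) (-(R⁻¹) ^ 2),
      ∀ y ∈ Metric.closedBall (0 : EuclideanSpace ℝ (Fin 3)) R,
        ‖Real.exp σ • W (Real.exp (2 * σ) * s) (Real.exp σ • y) - W s y‖ ≤ ε) :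
    ∃ l : ℕ → ℝ, Tendsto l atTop atTop ∧
      ∀ ε > 0, ∀ R > 1, ∀ᶠ n in atTop,
        ∀ s ∈ Set.Icc (-(R ^ 2)) (-(R⁻¹) ^ 2),
        ∀ y ∈ Metric.closedBall (0 : EuclideanSpace ℝ (Fin 3)) R,
          ‖Real.exp (l n) • W (Real.exp (2 * l n) * s) (Real.exp (l n) • y) - W s y‖ ≤ ε := by
  have h : ∀ n : ℕ, ∃ σ : ℝ, (n : ℝ) ≤ σ ∧
      ∀ s ∈ Set.Icc (-(((n : ℝ) + 2) ^ 2)) (-(((n : ℝ) + 2)⁻¹) ^ 2),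
      ∀ y ∈ Metric.closedBall (0 : EuclideanSpace ℝ (Fin 3)) ((n : ℝ) + 2),
        ‖Real.exp σ • W (Real.exp (2 * σ) * s) (Real.exp σ • y) - W s y‖ ≤ 1 / ((n : ℝ) + 1) := by
    intro n
    obtain ⟨L, -, hwin⟩ := hrec (1 / ((n : ℝ) + 1)) (by positivity) ((n : ℝ) + 2) (by linarith)
    obtain ⟨σ, hσ, hclose⟩ := hwin n
    exact ⟨σ, hσ.1, hclose⟩
  choose l hl hclose using h
  refine ⟨l, tendsto_atTop_mono hl tendsto_natCast_atTop_atTop, fun ε hε R hR => ?_⟩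
  have hR0 : 0 < R := one_pos.trans hR
  obtain ⟨N, hN⟩ := exists_nat_ge (max (1 / ε) R)
  refine eventually_atTop.2 ⟨N, fun n hn s hs y hy => ?_⟩
  have hnN : (N : ℝ) ≤ n := by exact_mod_cast hn
  have hRn : R ≤ (n : ℝ) + 2 := by linarith [le_max_right (1 / ε) R]
  have hεn : 1 / ((n : ℝ) + 1) ≤ ε := by
    rw [div_le_iff₀ (by positivity)]
    have h1 : 1 / ε ≤ (n : ℝ) + 1 := by linarith [le_max_left (1 / ε) R]
    rw [div_le_iff₀ hε] at h1
    linarith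
  obtain ⟨hs', hy'⟩ := window_mono hR0 hRn hs hy
  exact (hclose n s hs' y hy').trans hεn

/-! ### LaSalle on the hull -/

/-- **A Lyapunov functional is constant along a uniformly recurrent orbit** (LaSalle's invariance
principle on the hull, in the kernel's clauses). Let `P` be any scale-invariant property of fields
(`P V → P (V_c)` for `c > 0`) implying uniform recurrence, and `F` any real function of fields
which is antitone along the flow on `P`-fields and lower semicontinuous along recurrence sequences
at `P`-fields. Then `σ ↦ F(W_σ)` is constant for every `P`-field `W`. -/
theorem lyapunov_constant
    (P : (ℝ → EuclideanSpace ℝ (Fin 3) → EuclideanSpace ℝ (Fin 3)) → Prop)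
    (hP : ∀ V, P V → ∀ c : ℝ, 0 < c → P (nsRescale c V))
    (hPrec : ∀ V, P V → ∀ ε > 0, ∀ R > 1, ∃ L > 0, ∀ a : ℝ, ∃ σ ∈ Set.Icc a (a + L),
      ∀ s ∈ Set.Icc (-(R ^ 2)) (-(R⁻¹) ^ 2),
      ∀ y ∈ Metric.closedBall (0 : EuclideanSpace ℝ (Fin 3)) R,
        ‖Real.exp σ • V (Real.exp (2 * σ) * s) (Real.exp σ • y) - V s y‖ ≤ ε)
    (F : (ℝ → EuclideanSpace ℝ (Fin 3) → EuclideanSpace ℝ (Fin 3)) → ℝ)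
    (hmono : ∀ V, P V → ∀ σ τ : ℝ, σ ≤ τ →
      F (nsRescale (Real.exp τ) V) ≤ F (nsRescale (Real.exp σ) V))
    (hlsc : ∀ V, P V → ∀ l : ℕ → ℝ, Tendsto l atTop atTop →
      (∀ ε > 0, ∀ R > 1, ∀ᶠ n in atTop,
        ∀ s ∈ Set.Icc (-(R ^ 2)) (-(R⁻¹) ^ 2),
        ∀ y ∈ Metric.closedBall (0 : EuclideanSpace ℝ (Fin 3)) R,
          ‖Real.exp (l n) • V (Real.exp (2 * l n) * s) (Real.exp (l n) • y) - V s y‖ ≤ ε) →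
      ∀ δ > 0, ∀ᶠ n in atTop, F V - δ ≤ F (nsRescale (Real.exp (l n)) V))
    {W : ℝ → EuclideanSpace ℝ (Fin 3) → EuclideanSpace ℝ (Fin 3)} (hW : P W) :
    ∀ σ : ℝ, F (nsRescale (Real.exp σ) W) = F W := by
  -- `f σ = F (W_σ)` is antitone and recurs to each of its values far to the right
  have hconst := const_of_antitone_of_recurrence (f := fun σ => F (nsRescale (Real.exp σ) W))
    (fun σ τ hστ => hmono W hW σ τ hστ) ?_
  · intro σ
    have h := hconst σ 0
    rwa [nsRescale_exp_zero] at h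
  intro σ₀ δ hδ B
  -- the translate `V = W_{σ₀}` is a `P`-field, hence recurrent; extract `σ_n → ∞`
  have hV : P (nsRescale (Real.exp σ₀) W) := hP W hW _ (Real.exp_pos σ₀)
  obtain ⟨l, hl, hclose⟩ := exists_seq_of_recurrent (hPrec _ hV)
  have h1 := hlsc _ hV l hl hclose δ hδ
  have h2 : ∀ᶠ n in atTop, B - σ₀ ≤ l n := hl.eventually (eventually_ge_atTop (B - σ₀))
  obtain ⟨n, hn1, hn2⟩ := (h1.and h2).exists
  refine ⟨σ₀ + l n, by linarith, ?_⟩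
  simpa only [nsRescale_exp_add] using hn1

end Summit.NavierStokesRegularity.NavierStokesRegularity.Theorems.FiniteDissipationLiouville.Lyapunov

end
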